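import Literature.MathematicalPhysics.KineticTheory.HardSphereEEPNormalisation
import HarnessLib

/-!
# Gaussian convolution and the Fokker–Planck (adjoint Ornstein–Uhlenbeck) semigroup on Gaussians

Stage 2 groundwork for `HardSphereEEP` (Rezakhanlou–Villani, LNM 1916 (2008), Ch. 1 §1.4.2, proof of
Theorem 3, Lemma 2: "the FP semigroup acts as the rescaled convolution with `M`",
`S_t f = M_{1-e^{-2t}} * f_{e^{-2t}}`, and is compatible with the basic symmetries).

* `localMaxwellian_mul_localMaxwellian` — completing the square:
  `M_{1,x,a}(w) M_{1,c,b}(w) = M_{1,c,a+b}(x) · M_{1,m,ab/(a+b)}(w)`, `m = (b x + a c)/(a + b)`;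
* `integral_localMaxwellian_mul_localMaxwellian` — **Gaussian convolution**:
  `∫ M_{1,x,a}(w) M_{1,c,b}(w) dw = M_{1,c,a+b}(x)` (`N(c, b) * N(0, a) = N(c, a + b)` at the level
  of densities);
* `fokkerPlanck t f y = ∫ f(e^t y - √(e^{2t} - 1) z) e^{dt} M(z) dz` — the solution semigroup of
  the Fokker–Planck equation `∂_t f = Δf + ∇·(f v)` acting on densities (law of
  `e^{-t} X + √(1 - e^{-2t}) Z`, `Z ∼ M` independent of `X ∼ f`), written as a Mehler integral;
* `fokkerPlanck_localMaxwellian` — **Lemma 2 on Gaussians**: for `t ≥ 0`,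
  `S_t M_{1,c,θ} = M_{1, e^{-t} c, e^{-2t} θ + 1 - e^{-2t}}`; in particular `S_t M = M`
  (`fokkerPlanck_stdMaxwellian`), and the class of Gaussian mixtures `gaussMix p c θ δ` (which
  contains the normalised cloud laws, `cloudLawNormalised_eq_gaussMix`) is invariant:
  `fokkerPlanck_gaussMix`.
-/

namespace Literature.MathematicalPhysics.KineticTheory

open _root_.MeasureTheory Real Finset
open scoped InnerProductSpace BigOperators
open Literature.Analysis.FluidPDE (localMaxwellian)

noncomputable section

section General

variable {E : Type*} [NormedAddCommGroup E] [InnerProductSpace ℝ E]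

/-- The local Maxwellian only depends on the difference `w - c`: `M_{ρ,c,θ}(w) = M_{ρ,0,θ}(w - c)`.
[folklore] -/
theorem localMaxwellian_eq_sub (ρ θ : ℝ) (c w : E) :
    localMaxwellian ρ θ c w = localMaxwellian ρ θ 0 (w - c) := by
  simp [Literature.Analysis.FluidPDE.localMaxwellian]

/-- The local Maxwellian is symmetric in centre and argument: `M_{ρ,c,θ}(w) = M_{ρ,w,θ}(c)`.
[folklore] -/
theorem localMaxwellian_comm (ρ θ : ℝ) (c w : E) :
    localMaxwellian ρ θ c w = localMaxwellian ρ θ w c := by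
  simp [Literature.Analysis.FluidPDE.localMaxwellian, norm_sub_rev]

/-- The scalar identity behind completing the square, in inner-product form. [folklore] -/
theorem completing_square_exponent {a b : ℝ} (ha : 0 < a) (hb : 0 < b) (u u' : E) :
    -‖u‖ ^ 2 / (2 * a) + -‖u'‖ ^ 2 / (2 * b) =
      -‖u' - u‖ ^ 2 / (2 * (a + b)) +
        -‖(a + b)⁻¹ • (b • u + a • u')‖ ^ 2 / (2 * (a * b / (a + b))) := by
  have hab : 0 < a + b := by positivity
  rw [norm_smul, mul_pow, Real.norm_eq_abs, sq_abs, norm_sub_sq_real, norm_add_sq_real, norm_smul,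
    norm_smul, mul_pow, mul_pow, Real.norm_eq_abs, Real.norm_eq_abs, sq_abs, sq_abs,
    real_inner_smul_left, real_inner_smul_right, real_inner_comm u' u]
  field_simp
  ring

/-- **Completing the square**: for `a, b > 0`,
`M_{1,x,a}(w) M_{1,c,b}(w) = M_{1,c,a+b}(x) M_{1,m,ab/(a+b)}(w)` with the precision-weighted mean
`m = (b/(a+b)) x + (a/(a+b)) c`. [folklore] -/
theorem localMaxwellian_mul_localMaxwellian {a b : ℝ} (ha : 0 < a) (hb : 0 < b) (x c w : E) :
    localMaxwellian 1 a x w * localMaxwellian 1 b c w =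
      localMaxwellian 1 (a + b) c x *
        localMaxwellian 1 (a * b / (a + b)) ((b / (a + b)) • x + (a / (a + b)) • c) w := by
  set d : ℕ := Module.finrank ℝ E with hd
  have hab : 0 < a + b := by positivity
  unfold Literature.Analysis.FluidPDE.localMaxwellian
  simp only [one_mul]
  -- prefactors
  have hpre : (2 * π * a) ^ (-(d : ℝ) / 2) * (2 * π * b) ^ (-(d : ℝ) / 2) =
      (2 * π * (a + b)) ^ (-(d : ℝ) / 2) * (2 * π * (a * b / (a + b))) ^ (-(d : ℝ) / 2) := by
    rw [← Real.mul_rpow (by positivity) (by positivity), ← Real.mul_rpow (by positivity) (by positivity)]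
    congr 1
    field_simp
  -- exponents
  have hexp : -‖w - x‖ ^ 2 / (2 * a) + -‖w - c‖ ^ 2 / (2 * b) =
      -‖x - c‖ ^ 2 / (2 * (a + b)) +
        -‖w - ((b / (a + b)) • x + (a / (a + b)) • c)‖ ^ 2 / (2 * (a * b / (a + b))) := by
    have hvec : w - ((b / (a + b)) • x + (a / (a + b)) • c) =
        (a + b)⁻¹ • (b • (w - x) + a • (w - c)) := by
      rw [smul_add, smul_smul, smul_smul, smul_sub, smul_sub]
      have h1 : (a + b)⁻¹ * b = b / (a + b) := by rw [inv_mul_eq_div]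
      have h2 : (a + b)⁻¹ * a = a / (a + b) := by rw [inv_mul_eq_div]
      rw [h1, h2]
      have h3 : (b / (a + b)) • w + (a / (a + b)) • w = w := by
        rw [← add_smul, ← add_div, add_comm b a, div_self hab.ne', one_smul]
      calc w - ((b / (a + b)) • x + (a / (a + b)) • c)
          = ((b / (a + b)) • w + (a / (a + b)) • w) - ((b / (a + b)) • x + (a / (a + b)) • c) := by
            rw [h3]
        _ = _ := by abel
    have hxc : x - c = (w - c) - (w - x) := by abel
    rw [hvec, hxc]
    exact completing_square_exponent ha hb (w - x) (w - c)
  calc (2 * π * a) ^ (-(d : ℝ) / 2) * Real.exp (-‖w - x‖ ^ 2 / (2 * a)) *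
        ((2 * π * b) ^ (-(d : ℝ) / 2) * Real.exp (-‖w - c‖ ^ 2 / (2 * b)))
      = (2 * π * a) ^ (-(d : ℝ) / 2) * (2 * π * b) ^ (-(d : ℝ) / 2) *
          Real.exp (-‖w - x‖ ^ 2 / (2 * a) + -‖w - c‖ ^ 2 / (2 * b)) := by rw [Real.exp_add]; ring
    _ = (2 * π * (a + b)) ^ (-(d : ℝ) / 2) * (2 * π * (a * b / (a + b))) ^ (-(d : ℝ) / 2) *
          Real.exp (-‖x - c‖ ^ 2 / (2 * (a + b)) +
            -‖w - ((b / (a + b)) • x + (a / (a + b)) • c)‖ ^ 2 / (2 * (a * b / (a + b)))) := by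
        rw [hpre, hexp]
    _ = _ := by rw [Real.exp_add]; ring

variable [FiniteDimensional ℝ E] [MeasurableSpace E] [BorelSpace E]

/-- **Gaussian convolution**: `∫ M_{1,x,a}(w) M_{1,c,b}(w) dw = M_{1,c,a+b}(x)` for `a, b > 0` — the
density of `N(c, b·id) * N(0, a·id)` is that of `N(c, (a+b)·id)`. [folklore] -/
theorem integral_localMaxwellian_mul_localMaxwellian {a b : ℝ} (ha : 0 < a) (hb : 0 < b) (x c : E) :
    ∫ w, localMaxwellian 1 a x w * localMaxwellian 1 b c w = localMaxwellian 1 (a + b) c x := by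
  simp_rw [localMaxwellian_mul_localMaxwellian ha hb x c]
  rw [integral_const_mul, integral_localMaxwellian_one (by positivity), mul_one]

/-- **The Fokker–Planck (adjoint Ornstein–Uhlenbeck) semigroup** on velocity densities, as a Mehler
integral: `(S_t f)(y) = ∫ f(e^t y - √(e^{2t} - 1) z) e^{dt} M(z) dz`, the density of
`e^{-t} X + √(1 - e^{-2t}) Z` when `X ∼ f dv` and `Z ∼ M dv` are independent; it solves
`∂_t f = Δ f + ∇·(f v)` (Rezakhanlou–Villani 2008, Ch. 1 §1.4.1 (4) and §1.4.2 Lemma 2).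
[cite: RezakhanlouVillani2008, Ch. 1 §1.4.1 (4) p. 22] -/
def fokkerPlanck (t : ℝ) (f : E → ℝ) (y : E) : ℝ :=
  ∫ z, f (Real.exp t • y - Real.sqrt (Real.exp (2 * t) - 1) • z) *
    (Real.exp t ^ Module.finrank ℝ E * localMaxwellian 1 1 0 z)

/-- At `t = 0` the Fokker–Planck semigroup is the identity. [folklore] -/
theorem fokkerPlanck_zero (f : E → ℝ) : fokkerPlanck 0 f = f := by
  funext y
  simp only [fokkerPlanck, Real.exp_zero, one_smul, mul_zero, sub_self, Real.sqrt_zero, zero_smul,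
    sub_zero, one_pow, one_mul]
  rw [integral_const_mul, integral_localMaxwellian_one one_pos, mul_one]

/-- The variance of `S_t M_{1,c,θ}`: `e^{-2t} θ + 1 - e^{-2t}`. [folklore] -/
def ouVar (t θ : ℝ) : ℝ := Real.exp (-(2 * t)) * θ + (1 - Real.exp (-(2 * t)))

/-- `ouVar t θ > 0` for `θ > 0`, `t ≥ 0`. [folklore] -/
theorem ouVar_pos {t θ : ℝ} (ht : 0 ≤ t) (hθ : 0 < θ) : 0 < ouVar t θ := by
  unfold ouVar
  have h1 : Real.exp (-(2 * t)) ≤ 1 := Real.exp_le_one_iff.2 (by linarith)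
  have h2 : 0 < Real.exp (-(2 * t)) := Real.exp_pos _
  nlinarith

/-- `ouVar t 1 = 1`: the standard Maxwellian is stationary. [folklore] -/
theorem ouVar_one (t : ℝ) : ouVar t 1 = 1 := by unfold ouVar; ring

/-- **Lemma 2 on a Gaussian**: for `t ≥ 0` and `θ > 0`,
`S_t M_{1,c,θ} = M_{1, e^{-t}c, e^{-2t}θ + 1 - e^{-2t}}` (Rezakhanlou–Villani 2008, Ch. 1 §1.4.2
Lemma 2: `S_t` is the rescaled convolution with `M`). [cite: RezakhanlouVillani2008, Ch. 1 §1.4.2 Lemma 2 p. 28] -/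
theorem fokkerPlanck_localMaxwellian {t θ : ℝ} (ht : 0 ≤ t) (hθ : 0 < θ) (c : E) :
    fokkerPlanck t (localMaxwellian 1 θ c) = localMaxwellian 1 (ouVar t θ) (Real.exp (-t) • c) := by
  rcases eq_or_lt_of_le ht with h0 | htpos
  · subst h0
    have h1 : ouVar 0 θ = θ := by unfold ouVar; norm_num
    rw [fokkerPlanck_zero, h1, neg_zero, Real.exp_zero, one_smul]
  funext y
  set d : ℕ := Module.finrank ℝ E with hd
  set s : ℝ := Real.sqrt (Real.exp (2 * t) - 1) with hs
  have he : 1 < Real.exp (2 * t) := Real.one_lt_exp_iff.2 (by linarith)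
  have hs0 : 0 < s := Real.sqrt_pos.2 (by linarith)
  have hs2 : s ^ 2 = Real.exp (2 * t) - 1 := Real.sq_sqrt (by linarith)
  have het : 0 < Real.exp t := Real.exp_pos t
  -- Step 1: the integrand as a Gaussian in `z`
  have h1 : ∀ z : E, localMaxwellian 1 θ c (Real.exp t • y - s • z) =
      (s ^ d)⁻¹ * localMaxwellian 1 (θ / s ^ 2) (s⁻¹ • (Real.exp t • y - c)) z := by
    intro z
    have haff := localMaxwellian_affine 1 hθ.le (Real.exp t • y - c) 0 hs0 z
    rw [zero_add, sub_zero] at haff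
    rw [← haff]
    simp only [Literature.Analysis.FluidPDE.localMaxwellian]
    rw [show Real.exp t • y - s • z - c = -(s • z - (Real.exp t • y - c)) by abel, norm_neg]
  -- Step 2: convolution
  have h2 : ∫ z, localMaxwellian 1 (θ / s ^ 2) (s⁻¹ • (Real.exp t • y - c)) z * localMaxwellian 1 1 0 z =
      localMaxwellian 1 (θ / s ^ 2 + 1) 0 (s⁻¹ • (Real.exp t • y - c)) := by
    exact integral_localMaxwellian_mul_localMaxwellian (div_pos hθ (by positivity)) one_pos
      (s⁻¹ • (Real.exp t • y - c)) (0 : E)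
  -- Step 3: undo the scalings
  have h3 : localMaxwellian 1 (θ / s ^ 2 + 1) 0 (s⁻¹ • (Real.exp t • y - c)) =
      s ^ d * localMaxwellian 1 (θ + s ^ 2) 0 (Real.exp t • y - c) := by
    have := localMaxwellian_affine 1 (θ := θ + s ^ 2) (by positivity) 0 0 hs0 (s⁻¹ • (Real.exp t • y - c))
    rw [zero_add, smul_smul, mul_inv_cancel₀ hs0.ne', one_smul, sub_zero, smul_zero] at this
    have hθ' : θ / s ^ 2 + 1 = (θ + s ^ 2) / s ^ 2 := by field_simp
    rw [hθ', this, ← mul_assoc, mul_inv_cancel₀ (pow_ne_zero _ hs0.ne'), one_mul]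
  have h4 : localMaxwellian 1 (θ + s ^ 2) 0 (Real.exp t • y - c) =
      (Real.exp t ^ d)⁻¹ * localMaxwellian 1 (ouVar t θ) (Real.exp (-t) • c) y := by
    have hy : Real.exp t • y - c = 0 + Real.exp t • (y - Real.exp (-t) • c) := by
      rw [zero_add, smul_sub, smul_smul, ← Real.exp_add, add_neg_cancel, Real.exp_zero, one_smul]
    rw [hy, localMaxwellian_affine 1 (by positivity) 0 0 het, sub_zero, smul_zero,
      ← localMaxwellian_eq_sub]
    congr 2
    unfold ouVar
    rw [hs2, Real.exp_neg, show Real.exp (2 * t) = Real.exp t ^ 2 by rw [← Real.exp_nat_mul]; norm_num]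
    field_simp
  unfold fokkerPlanck
  rw [← hs]
  simp_rw [h1]
  calc ∫ z, (s ^ d)⁻¹ * localMaxwellian 1 (θ / s ^ 2) (s⁻¹ • (Real.exp t • y - c)) z *
        (Real.exp t ^ d * localMaxwellian 1 1 0 z)
      = (s ^ d)⁻¹ * Real.exp t ^ d *
          ∫ z, localMaxwellian 1 (θ / s ^ 2) (s⁻¹ • (Real.exp t • y - c)) z * localMaxwellian 1 1 0 z := by
        rw [← integral_const_mul]
        refine integral_congr_ae (Filter.Eventually.of_forall fun z => ?_)
        simp only
        ring
    _ = _ := by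
        rw [h2, h3, h4]
        field_simp

/-- The standard Maxwellian is a fixed point of the Fokker–Planck semigroup. [folklore] -/
theorem fokkerPlanck_stdMaxwellian {t : ℝ} (ht : 0 ≤ t) :
    fokkerPlanck t (localMaxwellian 1 1 (0 : E)) = localMaxwellian 1 1 0 := by
  rw [fokkerPlanck_localMaxwellian ht one_pos, ouVar_one, smul_zero]

/-- The Fokker–Planck semigroup is linear: finite linear combinations (no integrability needed for
the scalar, integrability for the sum). [folklore] -/
theorem fokkerPlanck_const_mul (t a : ℝ) (f : E → ℝ) :
    fokkerPlanck t (fun x => a * f x) = fun y => a * fokkerPlanck t f y := by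
  funext y
  simp only [fokkerPlanck, mul_assoc]
  rw [integral_const_mul]

omit [FiniteDimensional ℝ E] [MeasurableSpace E] [BorelSpace E] in
/-- `M_{ρ,c,θ} ≤ ρ (2πθ)^{-d/2}` (`ρ, θ ≥ 0`). [folklore] -/
theorem localMaxwellian_le_prefactor {ρ θ : ℝ} (hρ : 0 ≤ ρ) (hθ : 0 ≤ θ) (c x : E) :
    localMaxwellian ρ θ c x ≤ ρ * (2 * π * θ) ^ (-(Module.finrank ℝ E : ℝ) / 2) := by
  unfold Literature.Analysis.FluidPDE.localMaxwellian
  refine mul_le_of_le_one_right (mul_nonneg hρ (Real.rpow_nonneg (by positivity) _)) ?_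
  exact Real.exp_le_one_iff.2 (div_nonpos_of_nonpos_of_nonneg (neg_nonpos.2 (sq_nonneg _))
    (by positivity))

/-- The Mehler integrand of `S_t M_{1,c,θ}` is integrable (`θ > 0`). [folklore] -/
theorem integrable_fokkerPlanck_integrand_localMaxwellian (t : ℝ) {θ : ℝ} (hθ : 0 < θ) (c y : E) :
    Integrable fun z : E => localMaxwellian 1 θ c
      (Real.exp t • y - Real.sqrt (Real.exp (2 * t) - 1) • z) *
        (Real.exp t ^ Module.finrank ℝ E * localMaxwellian 1 1 0 z) := by
  refine Integrable.bdd_mul (c := 1 * (2 * π * θ) ^ (-(Module.finrank ℝ E : ℝ) / 2))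
    ((integrable_localMaxwellian one_pos (0 : E)).const_mul _)
    ((continuous_localMaxwellian 1 θ c).comp (by fun_prop)).aestronglyMeasurable
    (Filter.Eventually.of_forall fun z => ?_)
  rw [Real.norm_eq_abs, abs_of_nonneg (localMaxwellian_nonneg zero_le_one hθ.le _ _)]
  exact localMaxwellian_le_prefactor zero_le_one hθ.le _ _

end General

/-! ## The Gaussian-mixture class of the normalised cloud laws -/

variable {n : ℕ}

/-- The **Gaussian-mixture class** `(1 - δ) Σ_i p_i M_{1,c_i,θ} + δ M_{1,0,1}` on `ℝ³`: it contains
the normalised cloud laws of `HardSphereEEP` (`cloudLawNormalised_eq_gaussMix`) and is invariant under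
the Fokker–Planck semigroup (`fokkerPlanck_gaussMix`). [folklore] -/
def gaussMix (p : Fin n → ℝ) (c : Fin n → V3) (θ δ : ℝ) (x : V3) : ℝ :=
  (1 - δ) * (∑ i, p i * localMaxwellian 1 θ (c i) x) + δ * localMaxwellian 1 1 0 x

/-- The normalised cloud law is the Gaussian mixture with centres `(v_i - ū)/√T` and variance
`h²/T`. [folklore] -/
theorem cloudLawNormalised_eq_gaussMix (p : Fin n → ℝ) (v : Fin n → V3) (h δ : ℝ) :
    cloudLawNormalised p v h δ =
      gaussMix p (fun i => (Real.sqrt (cloudTemp p v h))⁻¹ • (v i - cloudMean p v))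
        ((h / Real.sqrt (cloudTemp p v h)) ^ 2) δ := rfl

/-- **The Gaussian-mixture class is Fokker–Planck invariant** (Lemma 2 on the class): for `t ≥ 0`,
`θ > 0`, `S_t (gaussMix p c θ δ) = gaussMix p (e^{-t} c) (e^{-2t}θ + 1 - e^{-2t}) δ`.
[cite: RezakhanlouVillani2008, Ch. 1 §1.4.2 Lemma 2 p. 28] -/
theorem fokkerPlanck_gaussMix {t θ : ℝ} (ht : 0 ≤ t) (hθ : 0 < θ) (p : Fin n → ℝ) (c : Fin n → V3)
    (δ : ℝ) :
    fokkerPlanck t (gaussMix p c θ δ) =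
      gaussMix p (fun i => Real.exp (-t) • c i) (ouVar t θ) δ := by
  funext y
  set s : ℝ := Real.sqrt (Real.exp (2 * t) - 1) with hs
  set w : V3 → ℝ := fun z => Real.exp t ^ Module.finrank ℝ V3 * localMaxwellian 1 1 0 z with hw
  have hI : ∀ i, Integrable fun z : V3 => p i *
      (localMaxwellian 1 θ (c i) (Real.exp t • y - s • z) * w z) := fun i =>
    (integrable_fokkerPlanck_integrand_localMaxwellian t hθ (c i) y).const_mul _
  have hM : Integrable fun z : V3 => localMaxwellian 1 1 0 (Real.exp t • y - s • z) * w z :=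
    integrable_fokkerPlanck_integrand_localMaxwellian t one_pos 0 y
  have hexp : ∀ z : V3, gaussMix p c θ δ (Real.exp t • y - s • z) * w z =
      (1 - δ) * (∑ i, p i * (localMaxwellian 1 θ (c i) (Real.exp t • y - s • z) * w z)) +
        δ * (localMaxwellian 1 1 0 (Real.exp t • y - s • z) * w z) := by
    intro z
    simp only [gaussMix, add_mul, mul_assoc, Finset.sum_mul]
  have hcomp : ∀ i, ∫ z, localMaxwellian 1 θ (c i) (Real.exp t • y - s • z) * w z =
      localMaxwellian 1 (ouVar t θ) (Real.exp (-t) • c i) y := fun i => by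
    have := congrFun (fokkerPlanck_localMaxwellian ht hθ (c i)) y
    exact this
  have hstd : ∫ z, localMaxwellian 1 1 0 (Real.exp t • y - s • z) * w z = localMaxwellian 1 1 0 y := by
    have := congrFun (fokkerPlanck_stdMaxwellian (E := V3) ht) y
    exact this
  unfold fokkerPlanck
  rw [← hs]
  simp_rw [show ∀ z : V3, Real.exp t ^ Module.finrank ℝ V3 * localMaxwellian 1 1 0 z = w z from
    fun z => rfl, hexp]
  rw [integral_add ((integrable_finsetSum _ fun i _ => hI i).const_mul _) (hM.const_mul _),
    integral_const_mul, integral_const_mul, integral_finsetSum _ fun i _ => hI i]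
  simp_rw [integral_const_mul, hcomp, hstd]
  rfl

end

end Literature.MathematicalPhysics.KineticTheory
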